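import Mathlib
import HarnessLib
import Summits.ValiantsHypothesis.ValiantsHypothesis.Theses.MonotoneRestoration
import Summits.ValiantsHypothesis.ValiantsHypothesis.Theorems.MonotoneRestorationOrbitRestorationLinearVolumeQPBlockDescentImage
import Summits.ValiantsHypothesis.ValiantsHypothesis.Theorems.MonotoneRestorationOrbitRestorationLinearVolumeQPBlockDescentRestricted
import Summits.ValiantsHypothesis.ValiantsHypothesis.Theorems.MonotoneRestorationOrbitRestorationLinearVolumeQPOrbitSpanCharacterisation
import Summits.ValiantsHypothesis.ValiantsHypothesis.Theorems.MonotoneRestorationOrbitCompressionQPOrbitToNarrowOfDescent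
import Summits.ValiantsHypothesis.ValiantsHypothesis.Theorems.MonotoneRestorationOrbitRestorationLinearVolumeQPNarrow

/-!
# Route MonotoneRestoration — aside `OrbitRestorationLinearVolumeQP` (stmt-ValiantsHypothesis-18294):
# BLOCK DESCENT, circuit form — THE REGISTERED STUB IN THE CRUX'S OWN LANGUAGE: the stub's conclusion for a family
# `g` holds iff `g` has a LIFT FAMILY computed by square-symmetric circuits of quasi-polynomial ORBIT size

The crux R1 = `OrbitRestorationLinearVolumeQP` says: every `VP ∩ LV` family is computed, level by level, by
square-symmetric circuits of orbit size `≤ 2^((log₂ n + c)^c)`.  The registered stub `stub_lvNarrowSpan` says: every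
`VP ∩ LV` family lies level by level in the span of the homomorphism polynomials of BIPARTITE patterns of treewidth
`≤ (log₂ n + c)^c`.  Combining the block image theorem (`BlockDescent.mem_narrowSpan_iff_exists_narrow_lift`,
p830432: bipartitely narrow at level `n` ⟺ one-sortedly narrow lift at level `n + n`) with the span form of the
support theorem and one-sorted K2/K3 (`OrbitSupport.qpOrbitFamily_iff_diNarrowSpan`, p829254) puts the stub in the
crux's language:

* `stubConclusion_of_symmetric_lift` (⟸) — if `g_n = φ_n(Q_{n+n})` for a family `Q` with square-symmetric circuits of
  quasi-polynomial orbit size at every level (no size, `VP` or volume condition on `Q`), then the stub's conclusion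
  holds for `g`;
* `exists_narrow_lift_family` (⟹, construction) — narrow lifts chosen level by level assemble into a square-symmetric,
  one-sortedly narrow lift family (`Q_k = 0` at odd `k`);
* `stubConclusion_iff_exists_symmetric_lift` — **for EVERY family `g`: [every `g_n` bipartitely narrow of width
  `(log₂ n + c)^c`] ⟺ [`g` has a lift family `Q` (`φ_n(Q_{n+n}) = g_n`) computed by square-symmetric circuits of
  quasi-polynomial orbit size]**;
* `lvNarrowSpan_iff_symmetric_lifts` — hence **`LvNarrowSpan` (verbatim the hypothesis of
  `OrbitRestorationLinearVolumeQPNarrow.orbitRestorationLinearVolumeQP_of_lvNarrowSpan`) ⟺ every `VP ∩ LV` family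
  has a qp-orbit square-symmetric LIFT FAMILY**, to be read next to R1: every `VP ∩ LV` family is ITSELF qp-orbit
  square-symmetric (restricting R1's circuits for `f` gives them for `f↓`, `…BlockDescentRestricted`; the converse
  passage `g ↦` some symmetric lift is the LIFT residue of `…BlockDescentLift`).

Honest label: an exact, VH-free reformulation of the registered stub; the stub (Dwivedi–Pago–Seppelt Outlook Q3 at qp
scale), R1 and VP ≠ VNP are NOT moved.  Def-free helper (`--supports stmt-ValiantsHypothesis-18294`); nothing here is
a named fact.

References: Dawar–Pago–Seppelt 2025 (arXiv:2502.06740) Thm 1.1, §5, §7 p. 45; Dawar–Wilsenach 2025 §6 (supports);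
Dwivedi–Pago–Seppelt 2026 (arXiv:2601.09343) eq. (1), Outlook Q3.
-/

noncomputable section

open scoped Classical

-- `Summit.ValiantsHypothesis.ValiantsHypothesis.…` is the tree's single-conjunct layout (Sub = Summit).
set_option linter.dupNamespace false

namespace Summit.ValiantsHypothesis.ValiantsHypothesis.Theorems.BlockDescentSymmetricLift

open Literature.Computability.AlgebraicComplexity MvPolynomial
open Literature.Combinatorics.SimpleGraph (treewidth)
open Summit.ValiantsHypothesis.ValiantsHypothesis.Theorems
open Summit.ValiantsHypothesis.ValiantsHypothesis.Theorems.BlockDescent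

/-! ### Members of the one-sorted narrow span are square-symmetric -/

/-- Every member of a one-sorted span `span{dihom_{D,N} : …}` is square-symmetric (invariant under the diagonal
renaming `x_ij ↦ x_{σ i, σ j}`). [folklore] -/
theorem ren_eq_of_mem_diNarrowSpan {N w : ℕ} (p : MvPolynomial (Fin N × Fin N) ℂ)
    (hp : p ∈ Submodule.span ℂ {q : MvPolynomial (Fin N × Fin N) ℂ |
      ∃ (a : ℕ) (D : Multiset (Fin a × Fin a)),
        treewidth (SimpleGraph.fromRel fun u v : Fin a => ∃ e ∈ D, u = e.1 ∧ v = e.2) ≤ w ∧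
          q = diHomPoly D N ℂ})
    (σ : Equiv.Perm (Fin N)) : ren σ p = p := by
  induction hp using Submodule.span_induction with
  | mem q hq =>
    obtain ⟨a, D, -, rfl⟩ := hq
    have hfun : (fun x : Fin N × Fin N => σ • x) = fun ij : Fin N × Fin N => (σ ij.1, σ ij.2) :=
      funext fun _ => rfl
    unfold ren
    rw [hfun]
    exact rename_perm_diHomPoly D N ℂ σ
  | zero => exact map_zero _
  | add x y _ _ hx hy => rw [map_add, hx, hy]
  | smul r x _ hx => rw [map_smul, hx]

/-- The one-sorted narrow span is monotone in the width. [folklore] -/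
theorem diNarrowSpan_mono (N : ℕ) {w w' : ℕ} (hw : w ≤ w') :
    Submodule.span ℂ {q : MvPolynomial (Fin N × Fin N) ℂ |
      ∃ (a : ℕ) (D : Multiset (Fin a × Fin a)),
        treewidth (SimpleGraph.fromRel fun u v : Fin a => ∃ e ∈ D, u = e.1 ∧ v = e.2) ≤ w ∧
          q = diHomPoly D N ℂ} ≤
    Submodule.span ℂ {q : MvPolynomial (Fin N × Fin N) ℂ |
      ∃ (a : ℕ) (D : Multiset (Fin a × Fin a)),
        treewidth (SimpleGraph.fromRel fun u v : Fin a => ∃ e ∈ D, u = e.1 ∧ v = e.2) ≤ w' ∧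
          q = diHomPoly D N ℂ} :=
  Submodule.span_mono fun _ ⟨a, D, hD, hq⟩ => ⟨a, D, hD.trans hw, hq⟩

/-- Transport along a trivial cast of the level is the identity. [folklore] -/
theorem rename_cast_self {n : ℕ} (e : n + n = n + n) (P : MvPolynomial (Fin (n + n) × Fin (n + n)) ℂ) :
    rename (Prod.map (Fin.cast e) (Fin.cast e)) P = P := by
  have h : (Prod.map (Fin.cast e) (Fin.cast e) : Fin (n + n) × Fin (n + n) → Fin (n + n) × Fin (n + n)) = id := by
    funext ij
    ext <;> simp
  rw [h, rename_id_apply]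

/-! ### (⟸) a lift family with quasi-polynomial-orbit square-symmetric circuits gives the stub's conclusion -/

/-- **Symmetric lifts suffice.**  If `g_n = φ_n(Q_{n+n})` for all `n`, for SOME family `Q` computed at every level by
square-symmetric circuits of quasi-polynomial ORBIT size (no size bound, `Q` need not be in `VP` or in the
linear-volume class), then every `g_n` lies in the span of the homomorphism polynomials of BIPARTITE patterns of
treewidth `≤ (log₂ n + c)^c` — the registered stub's conclusion for `g`.  (Support theorem in span form,
`OrbitSupport.diNarrowSpan_of_qpOrbitFamily`, p829254; then block descent.) [folklore] -/
theorem stubConclusion_of_symmetric_lift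
    (φ : (n : ℕ) → Fin (n + n) × Fin (n + n) → MvPolynomial (Fin n × Fin n) ℂ)
    (hφ : ∀ n (i j : Fin n), φ n (finSumFinEquiv (Sum.inl i), finSumFinEquiv (Sum.inr j)) = X (i, j) ∧
      φ n (finSumFinEquiv (Sum.inl i), finSumFinEquiv (Sum.inl j)) = 0 ∧
      φ n (finSumFinEquiv (Sum.inr i), finSumFinEquiv (Sum.inl j)) = 0 ∧
      φ n (finSumFinEquiv (Sum.inr i), finSumFinEquiv (Sum.inr j)) = 0)
    (g : (n : ℕ) → MvPolynomial (Fin n × Fin n) ℂ) (Q : (k : ℕ) → MvPolynomial (Fin k × Fin k) ℂ)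
    (hQg : ∀ n, aeval (φ n) (Q (n + n)) = g n)
    (hQ : ∃ c : ℕ, ∀ k : ℕ, ∃ (G : Type) (_ : Fintype G) (C : LabelledArithCircuit ℂ (Fin k × Fin k) Unit G),
      C.IsSymmetric (Equiv.Perm (Fin k)) ∧ C.eval (C.output ()) = Q k ∧
      C.orbitSize (Equiv.Perm (Fin k)) ≤ 2 ^ ((Nat.log 2 k + c) ^ c)) :
    ∃ c : ℕ, ∀ n : ℕ, g n ∈ Submodule.span ℂ {q : MvPolynomial (Fin n × Fin n) ℂ |
      ∃ (a b : ℕ) (F : Multiset (Fin a × Fin b)),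
        treewidth (SimpleGraph.fromRel fun u v : Fin a ⊕ Fin b =>
            ∃ e ∈ F, u = Sum.inl e.1 ∧ v = Sum.inr e.2) ≤ (Nat.log 2 n + c) ^ c ∧
          q = homPoly F n ℂ} := by
  obtain ⟨c, hc⟩ := OrbitSupport.diNarrowSpan_of_qpOrbitFamily Q hQ
  refine ⟨c + 1, fun n => ?_⟩
  rw [← hQg n]
  exact OrbitToNarrowOfDescent.narrowSpan_mono n (BlockDescentRestricted.width_double_le n c)
    (block_descent_span (φ n) (hφ n) _ _ (hc (n + n)))

/-! ### (⟹) the stub's conclusion gives a lift family with quasi-polynomial-orbit square-symmetric circuits -/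

/-- **Narrow lifts assemble into a square-symmetric, one-sortedly narrow LIFT FAMILY.**  If every `g_n` lies in the
bipartite narrow span of width `(log₂ n + c)^c`, there is a family `Q` (level `k`; `Q_k = 0` at odd `k`) with
`φ_n(Q_{n+n}) = g_n`, square-symmetric at every level, and `Q_k` in the one-sorted narrow span of width
`(log₂ k + c)^c` (image theorem `BlockDescent.mem_narrowSpan_iff_exists_narrow_lift`). [folklore] -/
theorem exists_narrow_lift_family
    (φ : (n : ℕ) → Fin (n + n) × Fin (n + n) → MvPolynomial (Fin n × Fin n) ℂ)
    (hφ : ∀ n (i j : Fin n), φ n (finSumFinEquiv (Sum.inl i), finSumFinEquiv (Sum.inr j)) = X (i, j) ∧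
      φ n (finSumFinEquiv (Sum.inl i), finSumFinEquiv (Sum.inl j)) = 0 ∧
      φ n (finSumFinEquiv (Sum.inr i), finSumFinEquiv (Sum.inl j)) = 0 ∧
      φ n (finSumFinEquiv (Sum.inr i), finSumFinEquiv (Sum.inr j)) = 0)
    (g : (n : ℕ) → MvPolynomial (Fin n × Fin n) ℂ) (c : ℕ)
    (hg : ∀ n : ℕ, g n ∈ Submodule.span ℂ {q : MvPolynomial (Fin n × Fin n) ℂ |
      ∃ (a b : ℕ) (F : Multiset (Fin a × Fin b)),
        treewidth (SimpleGraph.fromRel fun u v : Fin a ⊕ Fin b =>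
            ∃ e ∈ F, u = Sum.inl e.1 ∧ v = Sum.inr e.2) ≤ (Nat.log 2 n + c) ^ c ∧
          q = homPoly F n ℂ}) :
    ∃ Q : (k : ℕ) → MvPolynomial (Fin k × Fin k) ℂ,
      (∀ n, aeval (φ n) (Q (n + n)) = g n) ∧
      (∀ (k : ℕ) (σ : Equiv.Perm (Fin k)), ren σ (Q k) = Q k) ∧
      ∀ k : ℕ, Q k ∈ Submodule.span ℂ {q : MvPolynomial (Fin k × Fin k) ℂ |
        ∃ (a : ℕ) (D : Multiset (Fin a × Fin a)),
          treewidth (SimpleGraph.fromRel fun u v : Fin a => ∃ e ∈ D, u = e.1 ∧ v = e.2) ≤ (Nat.log 2 k + c) ^ c ∧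
            q = diHomPoly D k ℂ} := by
  -- at every level `k`, a good candidate: narrow, and a lift of `g n` whenever `k = n + n`
  have hlev : ∀ k : ℕ, ∃ P : MvPolynomial (Fin k × Fin k) ℂ,
      P ∈ Submodule.span ℂ {q : MvPolynomial (Fin k × Fin k) ℂ |
        ∃ (a : ℕ) (D : Multiset (Fin a × Fin a)),
          treewidth (SimpleGraph.fromRel fun u v : Fin a => ∃ e ∈ D, u = e.1 ∧ v = e.2) ≤ (Nat.log 2 k + c) ^ c ∧
            q = diHomPoly D k ℂ} ∧
      ∀ (n : ℕ) (e : n + n = k),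
        aeval (φ n) (rename (Prod.map (Fin.cast e.symm) (Fin.cast e.symm)) P) = g n := by
    intro k
    by_cases hk : ∃ n, n + n = k
    · obtain ⟨n, rfl⟩ := hk
      obtain ⟨P, hP, hPg⟩ := (mem_narrowSpan_iff_exists_narrow_lift (φ n) (hφ n) _ _).1 (hg n)
      refine ⟨P, diNarrowSpan_mono (n + n) ?_ hP, fun n' e => ?_⟩
      · exact Nat.pow_le_pow_left (by have := Nat.log_mono_right (b := 2) (Nat.le_add_right n n); omega) c
      · obtain rfl : n' = n := by omega
        rw [rename_cast_self]
        exact hPg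
    · exact ⟨0, Submodule.zero_mem _, fun n e => (hk ⟨n, e⟩).elim⟩
  choose Q hQmem hQlift using hlev
  refine ⟨Q, fun n => ?_, fun k σ => ren_eq_of_mem_diNarrowSpan (Q k) (hQmem k) σ, hQmem⟩
  have h := hQlift (n + n) n rfl
  rwa [rename_cast_self] at h

/-- **THE REGISTERED STUB'S CONCLUSION ⟺ A QUASI-POLYNOMIAL-ORBIT SQUARE-SYMMETRIC LIFT FAMILY.**  For every
family `g` on the square matrices and block substitutions `φ_n`: every level `g_n` lies in the span of the
homomorphism polynomials of BIPARTITE patterns of treewidth `≤ (log₂ n + c)^c` (one constant `c`) IF AND ONLY IF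
`g` has a LIFT FAMILY `Q` — `φ_n(Q_{n+n}) = g_n` for all `n`, i.e. `g_n` is `Q_{n+n}` with `X ⊗ N` substituted —
computed at every level by SQUARE-SYMMETRIC CIRCUITS OF QUASI-POLYNOMIAL ORBIT SIZE.  Compare the crux R1 itself:
`g` (a `VP ∩ LV` family) is computed by square-symmetric circuits of quasi-polynomial orbit size.  So, in the crux's
own language: **R1 = "every VP∩LV family is qp-orbit-symmetric"; registered stub = "every VP∩LV family has a
qp-orbit-symmetric LIFT one level up"** (`⟸` support theorem + block descent; `⟹` image theorem + one-sorted K2/K3 via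
`OrbitSupport.qpOrbitFamily_of_diNarrowSpan`). [folklore] -/
theorem stubConclusion_iff_exists_symmetric_lift
    (φ : (n : ℕ) → Fin (n + n) × Fin (n + n) → MvPolynomial (Fin n × Fin n) ℂ)
    (hφ : ∀ n (i j : Fin n), φ n (finSumFinEquiv (Sum.inl i), finSumFinEquiv (Sum.inr j)) = X (i, j) ∧
      φ n (finSumFinEquiv (Sum.inl i), finSumFinEquiv (Sum.inl j)) = 0 ∧
      φ n (finSumFinEquiv (Sum.inr i), finSumFinEquiv (Sum.inl j)) = 0 ∧
      φ n (finSumFinEquiv (Sum.inr i), finSumFinEquiv (Sum.inr j)) = 0)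
    (g : (n : ℕ) → MvPolynomial (Fin n × Fin n) ℂ) :
    (∃ c : ℕ, ∀ n : ℕ, g n ∈ Submodule.span ℂ {q : MvPolynomial (Fin n × Fin n) ℂ |
      ∃ (a b : ℕ) (F : Multiset (Fin a × Fin b)),
        treewidth (SimpleGraph.fromRel fun u v : Fin a ⊕ Fin b =>
            ∃ e ∈ F, u = Sum.inl e.1 ∧ v = Sum.inr e.2) ≤ (Nat.log 2 n + c) ^ c ∧
          q = homPoly F n ℂ}) ↔
    ∃ Q : (k : ℕ) → MvPolynomial (Fin k × Fin k) ℂ,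
      (∀ n, aeval (φ n) (Q (n + n)) = g n) ∧
      ∃ c : ℕ, ∀ k : ℕ, ∃ (G : Type) (_ : Fintype G) (C : LabelledArithCircuit ℂ (Fin k × Fin k) Unit G),
        C.IsSymmetric (Equiv.Perm (Fin k)) ∧ C.eval (C.output ()) = Q k ∧
        C.orbitSize (Equiv.Perm (Fin k)) ≤ 2 ^ ((Nat.log 2 k + c) ^ c) := by
  constructor
  · rintro ⟨c, hc⟩
    obtain ⟨Q, hQg, hQsymm, hQmem⟩ := exists_narrow_lift_family φ hφ g c hc
    exact ⟨Q, hQg, OrbitSupport.qpOrbitFamily_of_diNarrowSpan Q hQsymm ⟨c, hQmem⟩⟩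
  · rintro ⟨Q, hQg, hQ⟩
    exact stubConclusion_of_symmetric_lift φ hφ g Q hQg hQ

/-- **Hence the registered stub `LvNarrowSpan`, verbatim the hypothesis of
`OrbitRestorationLinearVolumeQPNarrow.orbitRestorationLinearVolumeQP_of_lvNarrowSpan`, is EQUIVALENT to:
every `VP ∩ LV` family has a lift family computed by square-symmetric circuits of quasi-polynomial orbit size** —
to be read next to the crux `OrbitRestorationLinearVolumeQP`: every `VP ∩ LV` family is ITSELF so computed.
[folklore] -/
theorem lvNarrowSpan_iff_symmetric_lifts
    (φ : (n : ℕ) → Fin (n + n) × Fin (n + n) → MvPolynomial (Fin n × Fin n) ℂ)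
    (hφ : ∀ n (i j : Fin n), φ n (finSumFinEquiv (Sum.inl i), finSumFinEquiv (Sum.inr j)) = X (i, j) ∧
      φ n (finSumFinEquiv (Sum.inl i), finSumFinEquiv (Sum.inl j)) = 0 ∧
      φ n (finSumFinEquiv (Sum.inr i), finSumFinEquiv (Sum.inl j)) = 0 ∧
      φ n (finSumFinEquiv (Sum.inr i), finSumFinEquiv (Sum.inr j)) = 0) :
    (∀ f : (n : ℕ) → MvPolynomial (Fin n × Fin n) ℂ, IsVPFamily f →
      (∃ (c : ℕ) (m : ℕ → ℕ) (a b : (n : ℕ) → Fin (m n) → ℕ)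
          (E : (n : ℕ) → (i : Fin (m n)) → Multiset (Fin (a n i) × Fin (b n i)))
          (α : (n : ℕ) → Fin (m n) → ℂ),
        (∀ n, m n ≤ (n + 2) ^ c) ∧ (∀ n i, a n i + b n i ≤ c * (n + 1)) ∧
          ∀ n, f n = ∑ i : Fin (m n), C (α n i) * homPoly (E n i) n ℂ) →
      ∃ c : ℕ, ∀ n : ℕ, f n ∈ Submodule.span ℂ
        {p : MvPolynomial (Fin n × Fin n) ℂ | ∃ (a b : ℕ) (E : Multiset (Fin a × Fin b)),
          treewidth (SimpleGraph.fromRel fun u v : Fin a ⊕ Fin b =>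
                ∃ e ∈ E, u = Sum.inl e.1 ∧ v = Sum.inr e.2) ≤ (Nat.log 2 n + c) ^ c ∧
            p = homPoly E n ℂ}) ↔
    (∀ f : (n : ℕ) → MvPolynomial (Fin n × Fin n) ℂ, IsVPFamily f →
      (∃ (c : ℕ) (m : ℕ → ℕ) (a b : (n : ℕ) → Fin (m n) → ℕ)
          (E : (n : ℕ) → (i : Fin (m n)) → Multiset (Fin (a n i) × Fin (b n i)))
          (α : (n : ℕ) → Fin (m n) → ℂ),
        (∀ n, m n ≤ (n + 2) ^ c) ∧ (∀ n i, a n i + b n i ≤ c * (n + 1)) ∧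
          ∀ n, f n = ∑ i : Fin (m n), C (α n i) * homPoly (E n i) n ℂ) →
      ∃ Q : (k : ℕ) → MvPolynomial (Fin k × Fin k) ℂ,
        (∀ n, aeval (φ n) (Q (n + n)) = f n) ∧
        ∃ c : ℕ, ∀ k : ℕ, ∃ (G : Type) (_ : Fintype G) (C : LabelledArithCircuit ℂ (Fin k × Fin k) Unit G),
          C.IsSymmetric (Equiv.Perm (Fin k)) ∧ C.eval (C.output ()) = Q k ∧
          C.orbitSize (Equiv.Perm (Fin k)) ≤ 2 ^ ((Nat.log 2 k + c) ^ c)) :=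
  ⟨fun h f hf hLV => (stubConclusion_iff_exists_symmetric_lift φ hφ f).1 (h f hf hLV),
    fun h f hf hLV => (stubConclusion_iff_exists_symmetric_lift φ hφ f).2 (h f hf hLV)⟩


/-! ### v2 (append-only): the registered stub = the crux + symmetric lifting -/

/-- **STUB = CRUX + LIFT_sym (exact decomposition of the registered stub).**  `LvNarrowSpan` (the hypothesis of
`OrbitRestorationLinearVolumeQPNarrow.orbitRestorationLinearVolumeQP_of_lvNarrowSpan`) holds IF AND ONLY IF
(i) the crux R1 = `OrbitRestorationLinearVolumeQP` holds AND (ii) LIFT_sym: every `VP ∩ LV` family that is computed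
by square-symmetric circuits of quasi-polynomial orbit size has a LIFT FAMILY so computed (`φ_n(Q_{n+n}) = f_n`).
(`⟹`: the stub implies R1, tree theorem K2 + K3, and gives symmetric lifts outright, `lvNarrowSpan_iff_symmetric_lifts`;
`⟸`: R1 makes every `VP ∩ LV` family qp-orbit square-symmetric, LIFT_sym lifts it, `stubConclusion_of_symmetric_lift`
concludes.)  So the registered line `birth` over-shoots the crux by EXACTLY the VH-free-looking statement LIFT_sym;
nothing else separates them. [folklore] -/
theorem lvNarrowSpan_iff_crux_and_symmetricLift
    (φ : (n : ℕ) → Fin (n + n) × Fin (n + n) → MvPolynomial (Fin n × Fin n) ℂ)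
    (hφ : ∀ n (i j : Fin n), φ n (finSumFinEquiv (Sum.inl i), finSumFinEquiv (Sum.inr j)) = X (i, j) ∧
      φ n (finSumFinEquiv (Sum.inl i), finSumFinEquiv (Sum.inl j)) = 0 ∧
      φ n (finSumFinEquiv (Sum.inr i), finSumFinEquiv (Sum.inl j)) = 0 ∧
      φ n (finSumFinEquiv (Sum.inr i), finSumFinEquiv (Sum.inr j)) = 0) :
    (∀ f : (n : ℕ) → MvPolynomial (Fin n × Fin n) ℂ, IsVPFamily f →
      (∃ (c : ℕ) (m : ℕ → ℕ) (a b : (n : ℕ) → Fin (m n) → ℕ)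
          (E : (n : ℕ) → (i : Fin (m n)) → Multiset (Fin (a n i) × Fin (b n i)))
          (α : (n : ℕ) → Fin (m n) → ℂ),
        (∀ n, m n ≤ (n + 2) ^ c) ∧ (∀ n i, a n i + b n i ≤ c * (n + 1)) ∧
          ∀ n, f n = ∑ i : Fin (m n), C (α n i) * homPoly (E n i) n ℂ) →
      ∃ c : ℕ, ∀ n : ℕ, f n ∈ Submodule.span ℂ
        {p : MvPolynomial (Fin n × Fin n) ℂ | ∃ (a b : ℕ) (E : Multiset (Fin a × Fin b)),
          treewidth (SimpleGraph.fromRel fun u v : Fin a ⊕ Fin b =>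
                ∃ e ∈ E, u = Sum.inl e.1 ∧ v = Sum.inr e.2) ≤ (Nat.log 2 n + c) ^ c ∧
            p = homPoly E n ℂ}) ↔
    (Summit.ValiantsHypothesis.ValiantsHypothesis.Theses.MonotoneRestoration.OrbitRestorationLinearVolumeQP ∧
      ∀ f : (n : ℕ) → MvPolynomial (Fin n × Fin n) ℂ, IsVPFamily f →
        (∃ (c : ℕ) (m : ℕ → ℕ) (a b : (n : ℕ) → Fin (m n) → ℕ)
          (E : (n : ℕ) → (i : Fin (m n)) → Multiset (Fin (a n i) × Fin (b n i)))
          (α : (n : ℕ) → Fin (m n) → ℂ),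
        (∀ n, m n ≤ (n + 2) ^ c) ∧ (∀ n i, a n i + b n i ≤ c * (n + 1)) ∧
          ∀ n, f n = ∑ i : Fin (m n), C (α n i) * homPoly (E n i) n ℂ) →
        (∃ c : ℕ, ∀ n : ℕ, ∃ (G : Type) (_ : Fintype G) (C : LabelledArithCircuit ℂ (Fin n × Fin n) Unit G),
          C.IsSymmetric (Equiv.Perm (Fin n)) ∧ C.eval (C.output ()) = f n ∧
          C.orbitSize (Equiv.Perm (Fin n)) ≤ 2 ^ ((Nat.log 2 n + c) ^ c)) →
        ∃ Q : (k : ℕ) → MvPolynomial (Fin k × Fin k) ℂ,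
          (∀ n, aeval (φ n) (Q (n + n)) = f n) ∧
          (∃ c : ℕ, ∀ k : ℕ, ∃ (G : Type) (_ : Fintype G) (C : LabelledArithCircuit ℂ (Fin k × Fin k) Unit G),
          C.IsSymmetric (Equiv.Perm (Fin k)) ∧ C.eval (C.output ()) = Q k ∧
          C.orbitSize (Equiv.Perm (Fin k)) ≤ 2 ^ ((Nat.log 2 k + c) ^ c))) := by
  constructor
  · intro h
    refine ⟨OrbitRestorationLinearVolumeQPNarrow.orbitRestorationLinearVolumeQP_of_lvNarrowSpan h,
      fun f hf hLV _ => (stubConclusion_iff_exists_symmetric_lift φ hφ f).1 (h f hf hLV)⟩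
  · rintro ⟨hR1, hlift⟩ f hf hLV
    obtain ⟨Q, hQf, hQ⟩ := hlift f hf hLV (hR1 f hf hLV)
    exact stubConclusion_of_symmetric_lift φ hφ f Q hQf hQ

end Summit.ValiantsHypothesis.ValiantsHypothesis.Theorems.BlockDescentSymmetricLift

end
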